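import Summits.QuantumFields.BalabanUV.Beta.GAN24.FibreDFT
import Summits.QuantumFields.BalabanUV.Beta.GAN24.FibreBlockSolve

/-!
# `BalabanUV.Beta.GAN24.FibreArrowRows` — binder row G-an2-4 / (CONV-C), road P1-fibre, node N04 of `SKELETON-P1.md` (leaf P1-L04b, PART (a)):
# the rows of `BlochFibreMatrix.resid` on a FINITE PLANE-WAVE SUPERPOSITION (generic index; the L04a-independent layer of S1a)

NOT IN PRINT; OUR PROOF ATTEMPT.  HONEST FRAMING (cell contract, verbatim): «discharging `BetaPertH` makes Bałaban's UV stability UNCONDITIONAL — a real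
constructive-QFT result; it is NOT the continuum limit and NOT the Clay problem.»  HONEST DEPENDENCY (verbatim): «continuum YM on T⁴ ⇐ BetaPertH ∧ nine spine
estimates (0/9 proved); BetaPertH ⇐ (D1) ∧ (D4) ∧ CAP+tail; G-an2-4 gates asym, D1 and NE2/3/4.»  [folklore] finite-difference algebra over `ℂ` (no estimate,
no cited fact, no wall binder, no `def … : Prop`).  NOT summit progress; nothing of (CONV-C)'s K-slot is discharged here.

## What is proved (generic dimension `D`, generic finite index type `ι`, complex momenta `k : ι → ℂ^D`)
For a 1-form `A` and a scalar `μ` given POINTWISE as plane-wave superpositions `A κ x = Σ_i a_iκ · pw k_i x`, `μ x = Σ_i b_i · pw k_i x`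
(hypothesis form — no new definition; amplitudes `a : ι → ℂ^D`, `b : ι → ℂ`; `pw`, `dhat = ∂̂`, `dflat = ∂̂♭`, `lapSym = L` from `GAN24/FibreSymbols`, `dot` from `GAN24/FibreBlockSolve`):
* §1–§2 the representations `μ = Σ_i pw0 k_i b_i`, `A = Σ_i pw1 k_i a_i` and finite-sum linearity of `dz`, `codiff₁`, `curv`, `curvAdj`, `blockSum`, `contourSum`;
* §3 `curvAdj_curv_spw`, `gauge_spw`, `Gamma_spw`: the curl–curl term, the gauge column and the G-row quantity of a superposition are the
  superpositions of gan24-p1's single-wave symbols `2(L·a − ∂̂(∂̂♭·a))`, `∂̂ L b`, `L(∂̂♭·a)` (`FibreSymbols.curvAdj_curv_plane`/`gauge_plane`/`Gamma_plane` BY NAME);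
* §4 the constraint-multiplier feed ON THE BOX: `adjContourSum N φ κ (repZ z) = (z_κ+1)·φ_κ 0 + (N−1−z_κ)·φ_κ(−e_κ)` (`adjContourSum_repZ`; the `N` contour
  positions behind the point `repZ z` see only the blocks `0` and `−e_κ`), its form for a coarse `1`-Bloch `φ` and for `cfgφ (tens c v)` / `blochChar p`
  (plane-wave algebra `pw_zero_site`, `blochChar_eq_pw` from leaf-16's `GAN24/FibreDFT` BY NAME);
* §5 THE ROWS of `resid A φ μ`: EL rows `Σ_i (2(L_i a_iκ − ∂̂_iκ(∂̂♭_i·a_i)) − L_i ∂̂_iκ b_i)·pw k_i (repZ z) − adjContourSum N φ κ (repZ z)`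
  (`resid_spw_EL`, the abstract arrow-system EL row of `FibreBlockSolve.EL_row_Asol` per index), G rows `Σ_i L_i(∂̂♭_i·a_i)·(pw k_i (repZ z) − 1)`
  (`resid_spw_G`: the «Γ(repZ z) − Γ(0)» differencing), M row `Σ_i blockSum N (pw0 k_i b_i) 0` (`resid_spw_M`), Q rows `Σ_i contourSum N (pw1 k_i a_i) κ 0`
  (`resid_spw_Q`) — the last two to be closed by `FibreSymbols.blockSum_plane`/`contourSum_plane` (v1.1) by name.
PART (b) of leaf P1-L04b (the specialisation to the alias family `k_m = (p + 2π·repZ m)/N` with the box-DFT amplitudes of `GAN24/FibreDFT`, and the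
expansion `adjContourSum ↦ χ̂·s♭`) is NOT here.  Unit `b2b-balaban-gan24-formalise-leaf-06` (G-an2-4 formalisation swarm), 2026-08-19.
-/

noncomputable section

open Complex Finset
open scoped BigOperators
open Literature.MathematicalPhysics.QuantumFieldTheory.Balaban1983to89.Beta
open Literature.MathematicalPhysics.QuantumFieldTheory.LatticeForm (IsBloch repZ quo)
open Literature.Probability.LatticeModels (TorusSite)
open AffineAveraging (Site Form0 Form1 Form2 unitVec unitVec_apply dz curv curvAdj codiff₁ blockSum contourSum)
open BlochFibreUniqueness (adjContourSum adjContourSum_apply isBloch_one_iff' quo_eq_zero_of_lt)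
open BlochFibreMatrix (Idx cfgφ tens resid blochChar)
open Summit.QuantumFields.BalabanUV.Beta.GAN24.FibreSymbols (pw dhat dflat lapSym pw0 pw1 curvAdj_curv_plane gauge_plane Gamma_plane)
open Summit.QuantumFields.BalabanUV.Beta.GAN24.FibreBlockSolve (dot)
open Summit.QuantumFields.BalabanUV.Beta.GAN24.FibreDFT (pw_zero_site blochChar_eq_pw)

namespace Summit.QuantumFields.BalabanUV.Beta.GAN24.FibreArrowRows

variable {D : ℕ} {ι : Type*}

/-! ## §1 Plane-wave superpositions (hypothesis form: no new definitions) -/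

section Superpositions

variable [Fintype ι]

/-- [folklore] A scalar field given pointwise as `μ x = Σ_i b_i · pw k_i x` is the function `Σ_i pw0 k_i b_i`. -/
theorem eq_sum_pw0 {k : ι → Fin D → ℂ} {b : ι → ℂ} {μ : Form0 D ℂ} (hμ : ∀ x, μ x = ∑ i, b i * pw (k i) x) :
    μ = ∑ i, pw0 (k i) (b i) := by
  funext x; rw [hμ x, Finset.sum_apply]; rfl

/-- [folklore] A 1-form given pointwise as `A κ x = Σ_i a_iκ · pw k_i x` is the function `Σ_i pw1 k_i a_i`. -/
theorem eq_sum_pw1 {k : ι → Fin D → ℂ} {a : ι → Fin D → ℂ} {A : Form1 D ℂ} (hA : ∀ κ x, A κ x = ∑ i, a i κ * pw (k i) x) :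
    A = ∑ i, pw1 (k i) (a i) := by
  funext κ x; rw [hA κ x, Finset.sum_apply, Finset.sum_apply]; rfl

end Superpositions

/-! ## §2 Finite-sum linearity of the lattice operators -/

/-- [folklore] `dz` of a finite sum. -/
theorem dz_finset_sum (s : Finset ι) (f : ι → Form0 D ℂ) : dz (∑ i ∈ s, f i) = ∑ i ∈ s, dz (f i) := by
  funext κ x
  simp only [dz, Finset.sum_apply, Finset.sum_sub_distrib]

/-- [folklore] `codiff₁` of a finite sum. -/
theorem codiff₁_finset_sum (s : Finset ι) (A : ι → Form1 D ℂ) : codiff₁ (∑ i ∈ s, A i) = ∑ i ∈ s, codiff₁ (A i) := by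
  funext x
  simp only [codiff₁, Finset.sum_apply, Finset.sum_sub_distrib]
  congr 1 <;> exact Finset.sum_comm

/-- [folklore] `curv` of a finite sum. -/
theorem curv_finset_sum (s : Finset ι) (A : ι → Form1 D ℂ) : curv (∑ i ∈ s, A i) = ∑ i ∈ s, curv (A i) := by
  funext κ l x
  simp only [curv, Finset.sum_apply, Finset.sum_sub_distrib, Finset.sum_add_distrib]

/-- [folklore] `curvAdj` of a finite sum. -/
theorem curvAdj_finset_sum (s : Finset ι) (F : ι → Form2 D ℂ) : curvAdj (∑ i ∈ s, F i) = ∑ i ∈ s, curvAdj (F i) := by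
  funext μ y
  simp only [curvAdj, Finset.sum_apply, Finset.sum_sub_distrib, Finset.sum_add_distrib]
  congr 1 <;> congr 1 <;> exact Finset.sum_comm

/-- [folklore] `blockSum` of a finite sum. -/
theorem blockSum_finset_sum (N : ℕ) (s : Finset ι) (f : ι → Form0 D ℂ) :
    blockSum N (∑ i ∈ s, f i) = ∑ i ∈ s, blockSum N (f i) := by
  funext y
  simp only [blockSum, Finset.sum_apply]
  rw [Finset.sum_comm]

/-- [folklore] `contourSum` of a finite sum. -/
theorem contourSum_finset_sum (N : ℕ) (s : Finset ι) (A : ι → Form1 D ℂ) :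
    contourSum N (∑ i ∈ s, A i) = ∑ i ∈ s, contourSum N (A i) := by
  funext κ y
  simp only [contourSum, Finset.sum_apply]
  symm
  rw [Finset.sum_comm]
  refine Finset.sum_congr rfl fun b _ => ?_
  rw [Finset.sum_comm]

/-! ## §3 The local symbols on a superposition (gan24-p1's single-wave symbols, summed) -/

section Symbols

variable [Fintype ι]

/-- [folklore] **CURL–CURL TERM OF A SUPERPOSITION**: for `A = Σ_i a_i ⊗ pw k_i`,
`curvAdj (curv A) μ y = Σ_i 2(L_i a_iμ − ∂̂_iμ (∂̂♭_i·a_i)) · pw k_i y`. -/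
theorem curvAdj_curv_spw {k : ι → Fin D → ℂ} {a : ι → Fin D → ℂ} {A : Form1 D ℂ} (hA : ∀ κ x, A κ x = ∑ i, a i κ * pw (k i) x)
    (μ : Fin D) (y : Site D) :
    curvAdj (curv A) μ y = ∑ i, 2 * (lapSym (k i) * a i μ - dhat (k i) μ * dot (dflat (k i)) (a i)) * pw (k i) y := by
  rw [eq_sum_pw1 hA, curv_finset_sum, curvAdj_finset_sum,
    Finset.sum_congr rfl (fun i _ => curvAdj_curv_plane (k i) (a i)), Finset.sum_apply, Finset.sum_apply]
  rfl

/-- [folklore] **GAUGE COLUMN OF A SUPERPOSITION**: for `μ = Σ_i b_i · pw k_i`, `dz (codiff₁ (dz μ)) κ y = Σ_i ∂̂_iκ L_i b_i · pw k_i y`. -/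
theorem gauge_spw {k : ι → Fin D → ℂ} {b : ι → ℂ} {μ : Form0 D ℂ} (hμ : ∀ x, μ x = ∑ i, b i * pw (k i) x) (κ : Fin D) (y : Site D) :
    dz (codiff₁ (dz μ)) κ y = ∑ i, dhat (k i) κ * lapSym (k i) * b i * pw (k i) y := by
  rw [eq_sum_pw0 hμ, dz_finset_sum, codiff₁_finset_sum, dz_finset_sum,
    Finset.sum_congr rfl (fun i _ => gauge_plane (k i) (b i)), Finset.sum_apply, Finset.sum_apply]
  rfl

/-- [folklore] **G-ROW QUANTITY OF A SUPERPOSITION**: `Γ := codiff₁ (dz (codiff₁ A))` of `A = Σ_i a_i ⊗ pw k_i` is `Σ_i L_i (∂̂♭_i·a_i) · pw k_i`. -/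
theorem Gamma_spw {k : ι → Fin D → ℂ} {a : ι → Fin D → ℂ} {A : Form1 D ℂ} (hA : ∀ κ x, A κ x = ∑ i, a i κ * pw (k i) x) (y : Site D) :
    codiff₁ (dz (codiff₁ A)) y = ∑ i, lapSym (k i) * dot (dflat (k i)) (a i) * pw (k i) y := by
  rw [eq_sum_pw1 hA, codiff₁_finset_sum, dz_finset_sum, codiff₁_finset_sum,
    Finset.sum_congr rfl (fun i _ => Gamma_plane (k i) (a i)), Finset.sum_apply]
  rfl

/-- [folklore] Block sum of a scalar superposition = superposition of single-wave block sums. -/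
theorem blockSum_spw (N : ℕ) {k : ι → Fin D → ℂ} {b : ι → ℂ} {μ : Form0 D ℂ} (hμ : ∀ x, μ x = ∑ i, b i * pw (k i) x) (y : Site D) :
    blockSum N μ y = ∑ i, blockSum N (pw0 (k i) (b i)) y := by
  rw [eq_sum_pw0 hμ, blockSum_finset_sum, Finset.sum_apply]

/-- [folklore] Contour sum of a 1-form superposition = superposition of single-wave contour sums. -/
theorem contourSum_spw (N : ℕ) {k : ι → Fin D → ℂ} {a : ι → Fin D → ℂ} {A : Form1 D ℂ} (hA : ∀ κ x, A κ x = ∑ i, a i κ * pw (k i) x)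
    (κ : Fin D) (y : Site D) :
    contourSum N A κ y = ∑ i, contourSum N (pw1 (k i) (a i)) κ y := by
  rw [eq_sum_pw1 hA, contourSum_finset_sum, Finset.sum_apply, Finset.sum_apply]

end Symbols

/-! ## §4 The constraint-multiplier feed `adjContourSum N φ` on the box of the origin -/

section Box

variable {N : ℕ} [NeZero N]

/-- [folklore] A contour position `repZ z − s e_κ` with `s ≤ z_κ` lies in the block of the origin. -/
theorem quo_repZ_sub_of_le (z : TorusSite D N) (κ : Fin D) {s : ℕ} (hs : s ≤ (z κ).val) :
    quo N (repZ z - (s : ℤ) • unitVec κ) = 0 := by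
  refine quo_eq_zero_of_lt (fun j => ?_) (fun j => ?_)
  · simp only [Pi.sub_apply, Pi.smul_apply, unitVec_apply, smul_eq_mul, repZ]
    split_ifs with h
    · subst h; have : (s : ℤ) ≤ (z j).val := by exact_mod_cast hs
      linarith
    · simp only [mul_zero, sub_zero]; positivity
  · simp only [Pi.sub_apply, Pi.smul_apply, unitVec_apply, smul_eq_mul, repZ]
    have hj : ((z j).val : ℤ) < N := by exact_mod_cast ZMod.val_lt (z j)
    split_ifs with h
    · have : (0 : ℤ) ≤ s := by positivity
      linarith
    · linarith

/-- [folklore] A contour position `repZ z − s e_κ` with `z_κ < s < N` lies in the block `−e_κ`. -/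
theorem quo_repZ_sub_of_lt (z : TorusSite D N) (κ : Fin D) {s : ℕ} (hs : (z κ).val < s) (hsN : s < N) :
    quo N (repZ z - (s : ℤ) • unitVec κ) = -unitVec κ := by
  funext j
  simp only [quo, Pi.sub_apply, Pi.smul_apply, Pi.neg_apply, unitVec_apply, smul_eq_mul, repZ]
  have hN : (N : ℤ) ≠ 0 := by exact_mod_cast NeZero.ne N
  split_ifs with h
  · subst h
    have h1 : ((z j).val : ℤ) < s := by exact_mod_cast hs
    have h2 : (s : ℤ) < N := by exact_mod_cast hsN
    have hq : ((z j).val : ℤ) - (s : ℤ) * 1 = (((z j).val : ℤ) - s + N) + (-1) * (N : ℤ) := by ring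
    rw [hq, Int.add_mul_ediv_right _ _ hN, Int.ediv_eq_zero_of_lt (by linarith) (by linarith)]
    simp
  · simp only [mul_zero, sub_zero, neg_zero]
    exact Int.ediv_eq_zero_of_lt (by positivity) (by exact_mod_cast ZMod.val_lt (z j))

/-- [folklore] **THE FEED ON THE BOX**: at the fine site `repZ z` of the block of the origin the `N` contour positions behind it in direction `κ`
see the block `0` exactly `z_κ + 1` times and the block `−e_κ` the remaining `N − 1 − z_κ` times. -/
theorem adjContourSum_repZ (φ : Form1 D ℂ) (κ : Fin D) (z : TorusSite D N) :
    adjContourSum N φ κ (repZ z) = (((z κ).val : ℂ) + 1) * φ κ 0 + ((N : ℂ) - 1 - (z κ).val) * φ κ (-unitVec κ) := by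
  rw [adjContourSum_apply]
  have hv : (z κ).val + 1 ≤ N := ZMod.val_lt (z κ)
  rw [← Finset.sum_range_add_sum_Ico _ hv]
  have h1 : ∀ s ∈ Finset.range ((z κ).val + 1), φ κ (quo N (repZ z - (s : ℤ) • unitVec κ)) = φ κ 0 := by
    intro s hs
    rw [quo_repZ_sub_of_le z κ (Nat.lt_succ_iff.mp (Finset.mem_range.mp hs))]
  have h2 : ∀ s ∈ Finset.Ico ((z κ).val + 1) N, φ κ (quo N (repZ z - (s : ℤ) • unitVec κ)) = φ κ (-unitVec κ) := by
    intro s hs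
    rw [Finset.mem_Ico] at hs
    rw [quo_repZ_sub_of_lt z κ (by omega) hs.2]
  rw [Finset.sum_congr rfl h1, Finset.sum_congr rfl h2, Finset.sum_const, Finset.sum_const, Finset.card_range, Nat.card_Ico,
    nsmul_eq_mul, nsmul_eq_mul]
  have hc : ((N - ((z κ).val + 1) : ℕ) : ℂ) = (N : ℂ) - 1 - (z κ).val := by
    rw [Nat.cast_sub hv]; push_cast; ring
  rw [hc]; push_cast; ring

/-- [folklore] The feed of a coarse `1`-Bloch multiplier (`φ_κ (y + a) = χ a · φ_κ y`): `adjContourSum N φ κ (repZ z) = ((z_κ+1) + (N−1−z_κ)·χ(−e_κ)) · φ_κ 0`. -/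
theorem adjContourSum_repZ_of_isBloch {χ : Site D → ℂ} {φ : Form1 D ℂ} (hφ : ∀ κ, IsBloch 1 χ (φ κ)) (κ : Fin D) (z : TorusSite D N) :
    adjContourSum N φ κ (repZ z) = ((((z κ).val : ℂ) + 1) + ((N : ℂ) - 1 - (z κ).val) * χ (-unitVec κ)) * φ κ 0 := by
  rw [adjContourSum_repZ]
  have h := (isBloch_one_iff'.1 (hφ κ)) 0 (-unitVec κ)
  rw [zero_add] at h
  rw [h]; ring

omit [NeZero N] in
/-- [folklore] The constraint multiplier of a tensor configuration: `cfgφ (tens c v) κ y = c y · v_{φκ}`. -/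
theorem cfgφ_tens (c : Site D → ℂ) (v : Idx D N → ℂ) (κ : Fin D) (y : Site D) :
    cfgφ (tens c v) κ y = c y * v (Sum.inr (Sum.inr κ)) := rfl

/-- [folklore] The feed of a tensor configuration on the box: `((z_κ+1)·c 0 + (N−1−z_κ)·c(−e_κ)) · v_{φκ}`. -/
theorem adjContourSum_cfgφ_tens (c : Site D → ℂ) (v : Idx D N → ℂ) (κ : Fin D) (z : TorusSite D N) :
    adjContourSum N (cfgφ (tens c v)) κ (repZ z)
      = ((((z κ).val : ℂ) + 1) * c 0 + ((N : ℂ) - 1 - (z κ).val) * c (-unitVec κ)) * v (Sum.inr (Sum.inr κ)) := by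
  rw [adjContourSum_repZ, cfgφ_tens, cfgφ_tens]; ring

/-- [folklore] The feed of the Bloch-character configuration `tens (blochChar p) v`: `((z_κ+1) + (N−1−z_κ)·e^{−ip_κ}) · v_{φκ}`. -/
theorem adjContourSum_cfgφ_blochChar (p : Fin D → ℂ) (v : Idx D N → ℂ) (κ : Fin D) (z : TorusSite D N) :
    adjContourSum N (cfgφ (tens (⇑(blochChar p)) v)) κ (repZ z)
      = ((((z κ).val : ℂ) + 1) + ((N : ℂ) - 1 - (z κ).val) * cexp (-(I * p κ))) * v (Sum.inr (Sum.inr κ)) := by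
  rw [adjContourSum_cfgφ_tens, AddChar.map_zero_eq_one, blochChar_eq_pw, ← zero_sub, FibreSymbols.pw_sub_unitVec, pw_zero_site]
  ring

end Box

/-! ## §5 The rows of `resid` on a plane-wave superposition -/

section Rows

variable [Fintype ι] {N : ℕ} [NeZero N] {k : ι → Fin D → ℂ} {a : ι → Fin D → ℂ} {b : ι → ℂ} {A : Form1 D ℂ} {μ : Form0 D ℂ}

/-- [folklore] **EL ROWS** (index `inl (κ, z)`) of `resid A φ μ` for `A = Σ_i a_i ⊗ pw k_i`, `μ = Σ_i b_i · pw k_i`: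
`Σ_i (2(L_i a_iκ − ∂̂_iκ(∂̂♭_i·a_i)) − L_i ∂̂_iκ b_i) · pw k_i (repZ z) − (𝒬ᵀφ)_κ (repZ z)` — per index the EL row
`2(L·A_κ − ∂_κ(∂♭·A)) − L∂_κ μ` of `FibreBlockSolve.EL_row_Asol`; the feed kept in position space (its box values: §4). -/
theorem resid_spw_EL (hA : ∀ κ x, A κ x = ∑ i, a i κ * pw (k i) x) (hμ : ∀ x, μ x = ∑ i, b i * pw (k i) x) (φ : Form1 D ℂ)
    (κ : Fin D) (z : TorusSite D N) :
    resid A φ μ (Sum.inl (κ, z))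
      = (∑ i, (2 * (lapSym (k i) * a i κ - dhat (k i) κ * dot (dflat (k i)) (a i)) - lapSym (k i) * dhat (k i) κ * b i) * pw (k i) (repZ z))
        - adjContourSum N φ κ (repZ z) := by
  rw [BlochFibreMatrix.resid_inl, curvAdj_curv_spw hA, gauge_spw hμ, sub_right_comm, ← Finset.sum_sub_distrib]
  congr 1
  exact Finset.sum_congr rfl fun i _ => by ring

/-- [folklore] EL rows with the feed of a tensor configuration `φ = cfgφ (tens c v)` made explicit (§4). -/
theorem resid_spw_EL_tens (hA : ∀ κ x, A κ x = ∑ i, a i κ * pw (k i) x) (hμ : ∀ x, μ x = ∑ i, b i * pw (k i) x)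
    (c : Site D → ℂ) (v : Idx D N → ℂ) (κ : Fin D) (z : TorusSite D N) :
    resid A (cfgφ (tens c v)) μ (Sum.inl (κ, z))
      = (∑ i, (2 * (lapSym (k i) * a i κ - dhat (k i) κ * dot (dflat (k i)) (a i)) - lapSym (k i) * dhat (k i) κ * b i) * pw (k i) (repZ z))
        - ((((z κ).val : ℂ) + 1) * c 0 + ((N : ℂ) - 1 - (z κ).val) * c (-unitVec κ)) * v (Sum.inr (Sum.inr κ)) := by
  rw [resid_spw_EL hA hμ, adjContourSum_cfgφ_tens]

/-- [folklore] EL rows for the Bloch-character configuration `φ = cfgφ (tens (blochChar p) v)`: feed `((z_κ+1) + (N−1−z_κ)e^{−ip_κ})·v_{φκ}`. -/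
theorem resid_spw_EL_blochChar (hA : ∀ κ x, A κ x = ∑ i, a i κ * pw (k i) x) (hμ : ∀ x, μ x = ∑ i, b i * pw (k i) x)
    (p : Fin D → ℂ) (v : Idx D N → ℂ) (κ : Fin D) (z : TorusSite D N) :
    resid A (cfgφ (tens (⇑(blochChar p)) v)) μ (Sum.inl (κ, z))
      = (∑ i, (2 * (lapSym (k i) * a i κ - dhat (k i) κ * dot (dflat (k i)) (a i)) - lapSym (k i) * dhat (k i) κ * b i) * pw (k i) (repZ z))
        - ((((z κ).val : ℂ) + 1) + ((N : ℂ) - 1 - (z κ).val) * cexp (-(I * p κ))) * v (Sum.inr (Sum.inr κ)) := by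
  rw [resid_spw_EL hA hμ, adjContourSum_cfgφ_blochChar]

/-- [folklore] **G ROWS** (index `inr (inl z)`, `z ≠ 0`): `Γ(repZ z) − Γ(0) = Σ_i L_i (∂̂♭_i·a_i) · (pw k_i (repZ z) − 1)` — per index the G-row quantity
`L(∂♭·A)` of `FibreBlockSolve.G_row_Asol`, differenced against the origin (the block-constant gauge freedom: one free constant per fibre). -/
theorem resid_spw_G (hA : ∀ κ x, A κ x = ∑ i, a i κ * pw (k i) x) (φ : Form1 D ℂ) (μ : Form0 D ℂ) {z : TorusSite D N} (hz : z ≠ 0) :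
    resid A φ μ (Sum.inr (Sum.inl z)) = ∑ i, lapSym (k i) * dot (dflat (k i)) (a i) * (pw (k i) (repZ z) - 1) := by
  rw [BlochFibreMatrix.resid_inr_inl, if_neg hz, Gamma_spw hA, Gamma_spw hA, ← Finset.sum_sub_distrib]
  refine Finset.sum_congr rfl fun i _ => ?_
  rw [pw_zero_site]; ring

/-- [folklore] **M ROW** (index `inr (inl 0)`): the block sum of the multiplier superposition, `Σ_i blockSum N (pw0 k_i b_i) 0`
(closed form `b_i · Π_μ gsum` by `FibreSymbols.blockSum_plane`). -/
theorem resid_spw_M (hμ : ∀ x, μ x = ∑ i, b i * pw (k i) x) (A φ : Form1 D ℂ) :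
    resid A φ μ (Sum.inr (Sum.inl (0 : TorusSite D N))) = ∑ i, blockSum N (pw0 (k i) (b i)) 0 := by
  rw [BlochFibreMatrix.resid_inr_inl, if_pos rfl, blockSum_spw N hμ]

/-- [folklore] **Q ROWS** (index `inr (inr κ)`): the contour sums of the field superposition, `Σ_i contourSum N (pw1 k_i a_i) κ 0`
(closed form `a_iκ · S · s_κ` by `FibreSymbols.contourSum_plane`). -/
theorem resid_spw_Q (hA : ∀ κ x, A κ x = ∑ i, a i κ * pw (k i) x) (φ : Form1 D ℂ) (μ : Form0 D ℂ) (κ : Fin D) :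
    resid A φ μ (Sum.inr (Sum.inr κ) : Idx D N) = ∑ i, contourSum N (pw1 (k i) (a i)) κ 0 := by
  rw [BlochFibreMatrix.resid_inr_inr, contourSum_spw N hA]

end Rows

end Summit.QuantumFields.BalabanUV.Beta.GAN24.FibreArrowRows

end
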